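import Literature.Computability.AlgebraicComplexity.GKSS19Preprocessing
import Literature.Computability.AlgebraicComplexity.GKSS19Reconstruction
import HarnessLib

/-!
# Guo–Kumar–Saptharishi–Solomon 2019, Theorem 1.6 (`G_P` is a hitting-set generator): assembly
# of §3, modulo the low-variable case `n ≤ 1`

Cell `val-lit`, seat t19 (literature-prover); the assembly step of the discharge programme of
`GKSS2019_mainThm` (v2, erratum A34). THEOREM-ONLY (no definitions, no named facts); nothing here
bears on `VP ≠ VNP`, which is NOT proved.

Source: Z. Guo, M. Kumar, R. Saptharishi, N. Solomon, *Derandomization from algebraic hardness*,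
SIAM J. Comput. 51 (2022) = arXiv:1905.00091 [GuoKumarSaptharishiSolomon2019], §3 "Proof of the
Main Theorem" (held text `paper:arxiv-1905.00091`, p0011–p0012).

## What is here

* `reconstructionBound_le_pow` — the parameter arithmetic: for `s, D, d, k ≥ 1`, `2 ≤ n`, `m ≤ n`,
  `reconstructionBound k m d ((D+1)(s+2)+(D+1)+1) + k ≤ (s·D·d³·n^{10k} + 2)^15`;
* **`mainThm_of_lowVariables`** — `GKSS2019_mainThm` (with `c = 15`) follows from the §3 chain
  `preprocessing` → Obs. 21 translation with a good shifted grid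
  (`exists_shift_forall_grid_eval_ne_zero`, `psi_translate`) → `reconstruction`, GIVEN the
  low-variable injectivity statement for `m ≤ 1` ("`Q(Δ_0(P), Δ_1(P)) = 0 ⇒ Q = 0` for non-constant
  `P`", the `y`-grading/transcendence remark that makes the printed theorem true also for `n = 1`,
  where the printed bound `poly(n^k)` cannot absorb the `k` interpolation points). That statement is
  taken here as an explicit hypothesis `hlow` and is to be proved in a sibling file; this file
  introduces no `def … : Prop`.

## References
* [GuoKumarSaptharishiSolomon2019] arXiv:1905.00091, Thm 1.6 and §3 (p0006.txt:L52-57,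
  p0011–p0012).
-/

noncomputable section

open MvPolynomial

namespace Literature.Computability.AlgebraicComplexity

namespace GKSS2019

open Literature.Barriers.ValiantsHypothesis

/-! ### Parameter arithmetic -/

/-- Products of quantities below powers of `B`. [cite: GuoKumarSaptharishiSolomon2019, §3 (arXiv p0012.txt:L20-22), "poly(s, d, D, n^k)"] -/
private theorem mul_le_pow_add {B x y a b : ℕ} (hx : x ≤ B ^ a) (hy : y ≤ B ^ b) :
    x * y ≤ B ^ (a + b) := by
  rw [pow_add]; exact Nat.mul_le_mul hx hy

/-- Sums of two quantities below `B^a` are below `B^{a+1}` when `B ≥ 2`. [cite: GuoKumarSaptharishiSolomon2019, §3 (arXiv p0012.txt:L20-22)] -/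
private theorem add_le_pow_succ {B x y a : ℕ} (hB : 2 ≤ B) (hx : x ≤ B ^ a) (hy : y ≤ B ^ a) :
    x + y ≤ B ^ (a + 1) := by
  rw [pow_succ]
  calc x + y ≤ B ^ a + B ^ a := Nat.add_le_add hx hy
    _ = B ^ a * 2 := by ring
    _ ≤ B ^ a * B := Nat.mul_le_mul_left _ hB

/-- Monotonicity in the exponent (`B ≥ 1`). [cite: GuoKumarSaptharishiSolomon2019, §3 (arXiv p0012.txt:L20-22)] -/
private theorem le_pow_of_le_pow {B x a b : ℕ} (hB : 1 ≤ B) (hx : x ≤ B ^ a) (hab : a ≤ b) :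
    x ≤ B ^ b :=
  hx.trans (Nat.pow_le_pow_right hB hab)

/-- **The parameter arithmetic of §3**: the reconstruction bound (plus the `k` gates undoing the
translation) is below `(s·D·d³·n^{10k} + 2)^15` when `s, D, d, k ≥ 1`, `n ≥ 2`, `m ≤ n`.
[cite: GuoKumarSaptharishiSolomon2019, §3 (arXiv p0012.txt:L20-22), "its size is poly(s, d, D, n^k)"] -/
theorem reconstructionBound_le_pow {k m d n D s : ℕ} (hk : 0 < k) (hd : 0 < d) (hD : 0 < D)
    (hs : 0 < s) (hn : 2 ≤ n) (hm : m ≤ n) :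
    reconstructionBound k m d ((D + 1) * (s + 2) + (D + 1) + 1) + k ≤
      (s * D * d ^ 3 * n ^ (10 * k) + 2) ^ 15 := by
  obtain ⟨B, hB⟩ : ∃ B, s * D * d ^ 3 * n ^ (10 * k) + 2 = B := ⟨_, rfl⟩
  rw [hB]
  -- the atoms
  have hn1 : 1 ≤ n := by omega
  have hsD : 1 ≤ s * D := Nat.mul_pos hs hD
  have hd3 : 1 ≤ d ^ 3 := Nat.one_le_pow 3 d hd
  have hnk : 1 ≤ n ^ (10 * k) := Nat.one_le_pow _ _ hn1
  have e1 : s * D ≤ s * D * d ^ 3 := Nat.le_mul_of_pos_right _ hd3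
  have e2 : s * D * d ^ 3 ≤ s * D * d ^ 3 * n ^ (10 * k) := Nat.le_mul_of_pos_right _ hnk
  have e3 : n ^ (10 * k) ≤ s * D * d ^ 3 * n ^ (10 * k) :=
    Nat.le_mul_of_pos_left _ (Nat.mul_pos hsD hd3)
  have e4 : d ^ 3 ≤ s * D * d ^ 3 := Nat.le_mul_of_pos_left _ hsD
  have e5 : d ≤ d ^ 3 := Nat.le_self_pow (by omega) d
  have e6 : n ≤ n ^ (10 * k) := Nat.le_self_pow (by omega) n
  have e7 : 2 ^ 10 ≤ n ^ (10 * k) :=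
    (Nat.pow_le_pow_left hn 10).trans (Nat.pow_le_pow_right hn1 (by omega))
  have hB9 : 1026 ≤ B := by rw [← hB]; norm_num at e7 ⊢; omega
  have hB1 : 1 ≤ B := by omega
  have hB2 : 2 ≤ B := by omega
  have hsDB : s * D ≤ B := by rw [← hB]; omega
  have hnB : n ≤ B := by rw [← hB]; omega
  have hdB : d + 2 ≤ B := by rw [← hB]; omega
  have hG : (m + 1) ^ k ≤ B := by
    have hn2 : n + 1 ≤ n ^ 2 := by nlinarith
    calc (m + 1) ^ k ≤ (n + 1) ^ k := Nat.pow_le_pow_left (by omega) k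
      _ ≤ (n ^ 2) ^ k := Nat.pow_le_pow_left hn2 k
      _ = n ^ (2 * k) := by rw [← pow_mul]
      _ ≤ n ^ (10 * k) := Nat.pow_le_pow_right hn1 (by omega)
      _ ≤ B := by rw [← hB]; omega
  have hkB : k ≤ B := by
    calc k ≤ 2 ^ k := Nat.lt_two_pow_self.le
      _ ≤ n ^ k := Nat.pow_le_pow_left hn k
      _ ≤ n ^ (10 * k) := Nat.pow_le_pow_right hn1 (by omega)
      _ ≤ B := by rw [← hB]; omega
  have hBB : B ^ 2 = B * B := pow_two B
  have hs'' : (D + 1) * (s + 2) + (D + 1) + 1 ≤ B ^ 2 := by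
    have h1 : (D + 1) * (s + 2) + (D + 1) + 1 ≤ 9 * (s * D) := by nlinarith
    rw [hBB]
    exact h1.trans (Nat.mul_le_mul (by omega) hsDB)
  -- atoms as powers of `B`
  have a_m1 : m + 1 ≤ B ^ 1 := by rw [pow_one]; omega
  have a_m2 : m + 2 ≤ B ^ 1 := by rw [pow_one]; omega
  have a_2m2 : 2 * m + 2 ≤ B ^ 2 := by
    rw [hBB]; exact (by omega : 2 * m + 2 ≤ 2 * B).trans (Nat.mul_le_mul_right _ hB2)
  have a_G : (m + 1) ^ k ≤ B ^ 1 := by rw [pow_one]; exact hG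
  have a_2G : 2 * (m + 1) ^ k ≤ B ^ 2 := by
    rw [hBB]; exact (Nat.mul_le_mul_left 2 hG).trans (Nat.mul_le_mul_right _ hB2)
  have a_d2 : d + 2 ≤ B ^ 1 := by rw [pow_one]; exact hdB
  have a_d : d ≤ B ^ 1 := by rw [pow_one]; omega
  have a_m : m ≤ B ^ 1 := by rw [pow_one]; omega
  have a_dm : d - m ≤ B ^ 1 := by rw [pow_one]; omega
  have a_k : k ≤ B ^ 1 := by rw [pow_one]; exact hkB
  have a_3k1 : 3 * k + 1 ≤ B ^ 2 := by
    rw [hBB]; exact (by omega : 3 * k + 1 ≤ 4 * B).trans (Nat.mul_le_mul_right _ (by omega))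
  have a_one : ∀ j, 1 ≤ B ^ j := fun j => Nat.one_le_pow _ _ hB1
  have a_2d2 : 2 * (d + 1) ≤ B ^ 2 := by
    rw [hBB]; exact (by omega : 2 * (d + 1) ≤ 2 * B).trans (Nat.mul_le_mul_right _ hB2)
  -- the base: `≤ B^7`
  have hbase : ((m + 2) ^ 2 * ((m + 1) ^ k * (2 * m + 2))) * ((m + 1) * (m + 1) ^ k) ≤ B ^ 7 :=
    mul_le_pow_add (mul_le_pow_add (by rw [pow_two]; exact mul_le_pow_add a_m2 a_m2)
      (mul_le_pow_add a_G a_2m2)) (mul_le_pow_add a_m1 a_G)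
  -- the level cost: `≤ B^12`
  have hlev : levelCost k m d ((D + 1) * (s + 2) + (D + 1) + 1) ≤ B ^ 12 := by
    unfold levelCost
    have h11 : (d + 2) ^ 2 ≤ B ^ 2 := by rw [pow_two]; exact mul_le_pow_add a_d2 a_d2
    have h12 : 2 * (m + 1) ^ k + 1 ≤ B ^ 3 := add_le_pow_succ hB2 a_2G (a_one 2)
    have h13 : (m + 1) * (d * (2 * (m + 1) ^ k + 1)) ≤ B ^ 5 :=
      mul_le_pow_add a_m1 (mul_le_pow_add a_d h12)
    have h14 : (D + 1) * (s + 2) + (D + 1) + 1 + (m + 1) * (d * (2 * (m + 1) ^ k + 1)) ≤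
        B ^ 6 := add_le_pow_succ hB2 (le_pow_of_le_pow hB1 hs'' (by omega)) h13
    have h15 : (d + 2) ^ 2 * ((D + 1) * (s + 2) + (D + 1) + 1 +
        (m + 1) * (d * (2 * (m + 1) ^ k + 1))) ≤ B ^ 8 := mul_le_pow_add h11 h14
    have h1 : (d + 2) ^ 2 * ((D + 1) * (s + 2) + (D + 1) + 1 +
        (m + 1) * (d * (2 * (m + 1) ^ k + 1))) + 1 ≤ B ^ 9 :=
      add_le_pow_succ hB2 h15 (a_one 8)
    have h2 : ((d + 2) ^ 2 * ((D + 1) * (s + 2) + (D + 1) + 1 +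
        (m + 1) * (d * (2 * (m + 1) ^ k + 1))) + 1) * (m + 1) ^ k ≤ B ^ 10 :=
      mul_le_pow_add h1 a_G
    have h3 : (2 * (m + 1) ^ k) * (m + 1) ^ k ≤ B ^ 10 :=
      le_pow_of_le_pow hB1 (mul_le_pow_add a_2G a_G) (by omega)
    have h5 : ((d + 2) ^ 2 * ((D + 1) * (s + 2) + (D + 1) + 1 +
        (m + 1) * (d * (2 * (m + 1) ^ k + 1))) + 1) * (m + 1) ^ k +
        (2 * (m + 1) ^ k) * (m + 1) ^ k ≤ B ^ 11 := add_le_pow_succ hB2 h2 h3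
    have h4 : ((3 * k + 1) * (m + 1) ^ k) * m ≤ B ^ 11 :=
      le_pow_of_le_pow hB1 (mul_le_pow_add (mul_le_pow_add a_3k1 a_G) a_m) (by omega)
    exact add_le_pow_succ hB2 h5 h4
  -- total: four terms, each `≤ B^13`, and `4 ≤ B^2`
  unfold reconstructionBound
  have t1 : ((m + 2) ^ 2 * ((m + 1) ^ k * (2 * m + 2))) * ((m + 1) * (m + 1) ^ k) ≤ B ^ 13 :=
    le_pow_of_le_pow hB1 hbase (by omega)
  have t2 : levelCost k m d ((D + 1) * (s + 2) + (D + 1) + 1) * (d - m) ≤ B ^ 13 :=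
    mul_le_pow_add hlev a_dm
  have t3 : 2 * (d + 1) ≤ B ^ 13 := le_pow_of_le_pow hB1 a_2d2 (by omega)
  have t4 : k ≤ B ^ 13 := le_pow_of_le_pow hB1 a_k (by omega)
  have h4B : 4 ≤ B ^ 2 := by rw [hBB]; exact (by omega : 4 ≤ 2 * B).trans (Nat.mul_le_mul_right _ hB2)
  calc _ ≤ B ^ 13 + B ^ 13 + B ^ 13 + B ^ 13 :=
        Nat.add_le_add (Nat.add_le_add (Nat.add_le_add t1 t2) t3) t4
    _ = 4 * B ^ 13 := by ring
    _ ≤ B ^ 2 * B ^ 13 := Nat.mul_le_mul_right _ h4B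
    _ = B ^ 15 := by rw [← pow_add]

/-! ### Assembly -/

/-- **GKSS Theorem 1.6 from §3, modulo the low-variable case.** Assuming the injectivity
statement for `m ≤ 1` (`Q(Δ_0(P), …, Δ_m(P)) = 0 ⇒ Q = 0` for non-constant `P`; the `y`-grading
and transcendence remark, to be proved in a sibling file), `G_P^{≤ n}` hits `𝒞(n+1, D, s)` as soon as
`L(P) > (s·D·d³·n^{10k} + 2)^15`: a nonzero `Q` in the slice annihilated by `G_P^{≤ n}` is
preprocessed (`preprocessing`), `P` is translated by Obs. 21 so that a whole shifted grid is good
(`exists_shift_forall_grid_eval_ne_zero`, `psi_translate`), and the reconstruction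
(`reconstruction`) bounds `L(P)`, contradicting hardness (`reconstructionBound_le_pow`).
[cite: GuoKumarSaptharishiSolomon2019, Thm 1.6 and §3 (arXiv p0006.txt:L52-57, p0011-p0012)] -/
theorem mainThm_of_lowVariables
    (hlow : ∀ (F : Type) [Field F] [CharZero F] (k m : ℕ), m ≤ 1 →
      ∀ P : MvPolynomial (Fin k) F, 0 < P.totalDegree →
      ∀ Q : MvPolynomial (Fin (m + 1)) F, aeval (gen P m) Q = 0 → Q = 0) :
    GKSS2019_mainThm := by
  classical
  refine ⟨15, ?_⟩
  intro F _ _ k d n D s P hk hd hn hD hs hPd hhard Q hQmem hQne hroot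
  have hQdeg : Q.totalDegree ≤ D := hQmem.1
  have hQs : complexity Q ≤ s := hQmem.2
  have hrootA : aeval (gen P n) Q = 0 := by rwa [aeval_eq_bind₁]
  obtain ⟨m, hmn, Q'', hQ''s, h0S, h1S⟩ :=
    preprocessing (D := D) (s := s) P Q.vars.card Q le_rfl hQne hQdeg hQs hrootA
  by_cases hm1 : m ≤ 1
  · -- the low-variable case: `Q'' = 0`, contradicting `(∂ Q'')(Δ) ≠ 0`
    have hQ'' : Q'' = 0 := hlow F k m hm1 P (by omega) Q'' h0S
    exact h1S (by rw [hQ'', map_zero, map_zero])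
  · -- `m ≥ 2`, hence `n ≥ 2`
    have hn2 : 2 ≤ n := by omega
    -- transport to `R[y]`
    have h0R : aeval (fun i : Fin (m + 1) => homogeneousComponent (i : ℕ) (shiftR P)) Q'' = 0 := by
      rw [← bind₁_gen_eq_zero_iff, ← aeval_eq_bind₁]; exact h0S
    set W := aeval (fun i : Fin (m + 1) => homogeneousComponent (i : ℕ) (shiftR P))
      (pderiv (Fin.last m) Q'') with hW
    have hWne : W ≠ 0 := by
      intro h
      apply h1S
      rw [aeval_eq_bind₁, bind₁_gen_eq_zero_iff]
      exact h
    have hWt : (toZY F k).symm W ≠ 0 := by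
      intro h; exact hWne (by simpa using congrArg (toZY F k) h)
    -- a good point `(b, v + grid)` for the joint polynomial `W(z, y)`
    obtain ⟨V, hV⟩ := exists_shift_forall_grid_eval_ne_zero ((toZY F k).symm W) hWt m
    set b : Fin k → F := fun j => V (Sum.inl j) with hb
    set v : Fin k → F := fun j => V (Sum.inr j) with hv
    set Pb := aeval (fun j : Fin k => (X j + C (b j) : MvPolynomial (Fin k) F)) P with hPb
    -- hypotheses of the reconstruction for the translate `P(z + b)`
    have h0b : aeval (fun i : Fin (m + 1) => homogeneousComponent (i : ℕ) (shiftR Pb)) Q'' = 0 := by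
      rw [hPb, aeval_gen_translate, h0R, map_zero]
    have hΨb : ∀ α : Fin k → Fin (m + 1), constantCoeff (aeval (fun i : Fin (m + 1) =>
        eval (fun j => (C (v j + ((α j : ℕ) : F)) : MvPolynomial (Fin k) F))
          (homogeneousComponent (i : ℕ) (shiftR Pb))) (pderiv (Fin.last m) Q'')) ≠ 0 := by
      intro α
      rw [constantCoeff_aeval_eval, hPb, psi_translate, ← hW, eval_map_eval_eq_eval_toZY_symm]
      have hfun : (Sum.elim b fun j => v j + ((α j : ℕ) : F)) =
          fun i => V i + (((Sum.elim (fun _ => (0 : Fin (m + 1))) α : Fin k ⊕ Fin k → Fin (m + 1))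
            i : ℕ) : F) := by
        funext i
        rcases i with j | j
        · simp [hb]
        · simp [hv]
      rw [hfun]
      exact hV (Sum.elim (fun _ => (0 : Fin (m + 1))) α)
    have hPbd : Pb.totalDegree ≤ d := (totalDegree_translate_le b P).trans hPd.le
    have hrec := reconstruction Pb hPbd Q'' hQ''s h0b v hΨb
    have hcx : complexity P ≤
        reconstructionBound k m d ((D + 1) * (s + 2) + (D + 1) + 1) + k :=
      (complexity_le_complexity_translate_add b P).trans (Nat.add_le_add_right hrec k)
    have hbound := reconstructionBound_le_pow (m := m) hk hd hD hs hn2 hmn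
    omega

end GKSS2019

end Literature.Computability.AlgebraicComplexity
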